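import Literature.NumberTheory.ComplexMultiplication.CosetGermOrbitSumSquare
import HarnessLib

/-!
# Milne 1999 §6 pp. 68, 71–72 in the group ring: `X^*(T^K)`, `X^*(L^K)` as products of pairs and the last step of the proof of
# THEOREM 6.1 — the square `X^*(T^K) → X^*(S^K)` over `X^*(L^K) → X^*(P^K)` is almost cartesian
# (J. S. Milne, *Lefschetz motives and the Tate conjecture*, Compositio Math. 117 (1999), §1 p. 48, Thm 2.6, Thm 4.3, §6 pp. 68, 71–72)

Family `hodge`, lane `lit-hodgefound` (Layer A3; seat `lit-hodgefound-p27`, generation 17, row g17-#5); topic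
`Literature/NumberTheory/ComplexMultiplication`, namespaces `Literature.NumberTheory.ComplexMultiplication.PairProduct` (§0, generic) and
`….CosetGerm` (§§1–2).  Direct sequel of g17-#4 `CosetGermOrbitSumSquare` (LEMMA 6.10: the orbit-sum square `⊕_{Φ∈I} X^*(T^Φ) → X^*(S^K)` over
`⊕_{Π∈I′} X^*(L^Π) → X^*(P^K)` is almost cartesian, and the transfer lemma `IsAlmostCartesian.of_quotients`).  GROUP-RING ALGEBRA ONLY, in the
abstract `Setting ι Γ₀ D` of g17-#2 with coefficients `R` without zero divisors, `2 ≠ 0`, `d = |D| ≠ 0` in `R` (Milne: `ℤ`).  Definitions with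
bodies + THEOREMS; no named fact (D-0026, net debt 0).

THE PRINT.  [Milne1999] §1 p. 48 (held `paper:doi-10-1023-a-1000776613765` p0004 L31–L35), verbatim: «Let `(G_i, t_i)_{i∈I}` be a family of pairs
consisting of an algebraic group `G_i` and a homomorphism `t_i : G_i → 𝔾_m`. We define the product `∏_{i∈I}(G_i, t_i)` of the family to be the
pair `(G, t)` consisting of the largest subgroup of `∏ G_i` on which the characters `(g_i)_{i∈I} ↦ t_{i₀}(g_{i₀})` agree and of the common
restriction of these characters to `G`. It is universal with respect to the maps `(G, t) → (G_i, t_i)`.»  THEOREM 2.6 (p. 56 = p0012 L26–L29):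
«For any CM-subfield `K` of `ℚ^{al}`, the fundamental group `(T^K, t^K)` of `LCM^K(ℂ)` is `∏_Ψ (T^Ψ, t^Ψ)`, where the product is over the set of
`Γ`-orbits of CM-types on `K`.»  §4 p. 62 (p0018 L15–L16): «… whose fundamental group is `∏_{Π∈Γ\W^K_{1,+}(p^∞)} (L^Π, l^Π)`» [printed `t^Π`].
§6 p. 68 (p0024 L106–L118, p0025 L4–L6): «Completion of the proof of the Theorem 6.1. It suffices to prove that [`X^*(T^K) → X^*(S^K)` over
`X^*(L^K) → X^*(P^K)`] is almost Cartesian for all sufficiently large CM-fields `K ⊂ ℚ^{al}` of finite degree over `ℚ`. We shall in fact prove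
it under the assumption that `K` – is finite and Galois over `ℚ`, – contains a quadratic imaginary extension `Q` of `ℚ` in which `(p)` splits,
– and is not equal to `Q`.»  §6 p. 71 L22 – p. 72 L4 (p0027, p0028): «Consider the diagram: `⊕_{Φ∈I} X^*(T^Φ) → X^*(T^K) → X^*(S^K)` [over]
`⊕_{Π∈I′} X^*(L^Π) → X^*(L^K) → X^*(P^K)` [verticals `α″`, `α′`, `α`]. The last lemma shows that the composite of the maps `Ker(α″) → Ker(α′) →
Ker(α)` is surjective, which implies that `Ker(α′) → Ker(α)` is surjective. Therefore the right hand square is almost Cartesian, which completes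
the proof of Theorem 6.1.»

THE MODEL (continuing g17-#4's dictionary).  On character modules the product of pairs is the AMALGAMATED SUM: for a group of multiplicative
type `G_i` with character module `M_i` and `t_i ∈ M_i`, the largest subgroup of `∏ G_i` on which the `t_i` agree is the diagonalizable group of
`(⊕_i M_i)/⟨t_i − t_j : i, j⟩`, and `t` is the common class of the `t_i` — §0 **`PairProduct.rel t`** (the relations `δ_i t_i − δ_j t_j`),
**`PairProduct.Amalg t`** `= (Π i, M i) ⧸ rel t`, `mk_single_eq` (the common class), `liftOf` (the universal property: a map out of `⊕ M_i`
taking one value on all `δ_i t_i` factors), `mapOf` (functoriality).  §1: `X^*(T^K)` = **`TK`** = the amalgamated sum of the `X^*(T^c)`,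
`c ∈ I`, along `t^c = tChar` (g15-#1 `OrbitTorus.tChar`, at the base point `basePt c`; independent of it, `tChar_eq`), with **`tK`** `= t^K`;
`X^*(L^K)` = **`LK`** likewise over `I′` with **`lK`**; the arrows of the right-hand square: **`tKToS`** `: X^*(T^K) → X^*(S^K)` (from
g17-#4 `tSumToSs = γ`, well defined since every `t^c ↦ s^K = onesFun`), **`lKToP`** `: X^*(L^K) → X^*(P^K)` (from `lSumToPw = β`, `l^{c′} ↦
push(s^K)`), **`alphaK`** `= X^*(α′) : X^*(T^K) → X^*(L^K)` (from `alphaSum = α″`, `t^c ↦ l^{π(c)}`); `tKToS_tK`, `alphaK_tK`, `lKToP_lK`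
(the maps are maps of pairs).  §2: **`isAlmostCartesian_pairProduct`** — the right-hand square is almost cartesian — by g17-#4
`IsAlmostCartesian.of_quotients` applied to LEMMA 6.10 (`isAlmostCartesian_sum`) and the three quotient maps; **`exact_pairProduct`** — «`P^K =
S^K ∩ L^K` (inside `T^K`), or, equivalently, [`P^K → L^K × S^K → T^K`] is exact» (p. 66) read on characters: `X^*(T^K) → X^*(L^K) ⊕ X^*(S^K) →
X^*(P^K)` is exact (g16-#8 `isAlmostCartesian_iff_exact`); `int_isAlmostCartesian_pairProduct` over `ℤ`.

WHAT IS HERE (all PROVED): §0 DEF `PairProduct.rel` (`single_sub_single_mem`), `PairProduct.Amalg`, DEF `proj` (`proj_apply`, `proj_surjective`),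
`mk_single_eq`, DEF `liftOf` (`liftOf_mk`, `liftOf_surjective`), DEF `mapOf` (`mapOf_mk`, `mapOf_surjective`); §1 DEF `basePt`/`basePt'`, DEF `tFam`/`lFam` (`tChar_eq_tFam`, `tChar_eq_lFam`), `TK`,
`LK`, DEF `tK`, `lK` (`mk_single_tChar_eq_tK`, `mk_single_tChar_eq_lK`), DEF **`tKToS`** (`tKToS_mk`, `tKToS_tK`, `tKToS_surjective`), DEF
**`lKToP`** (`lKToP_mk`, `lKToP_lK`, `lKToP_surjective`), `alphaSum_single_tFam`, DEF **`alphaK`** (`alphaK_mk`, `alphaK_tK`, `alphaK_surjective`), `pairProduct_square_comm`;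
§2 **`isAlmostCartesian_pairProduct`**, **`exact_pairProduct`** (THEOREM 6.1 at level `K`, read on characters: `β(y) = X^*(α)(s) ⟺ (y, s)`
comes from `X^*(T^K)`), `int_isAlmostCartesian_pairProduct`.

NOT here: the passage from character modules back to the groups `P^K`, `L^K`, `S^K`, `T^K` themselves and the limit over `K` (THEOREM 6.1 as
printed, «identifies `P` with `L ∩ S`»; Layer B, B5-09), the number-theoretic instance of the `Setting`.

## References

* [Milne1999] J. S. Milne, *Lefschetz motives and the Tate conjecture*, Compositio Math. 117 (1999) 45–76 — §1 p. 48 (products of pairs),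
  Thm 2.6 p. 56, §4 p. 62 / Thm 4.3 p. 61, §6 p. 68 («Completion of the proof of the Theorem 6.1»), p. 71 L22 – p. 72 L4 (held
  `paper:doi-10-1023-a-1000776613765` p0004, p0012, p0017, p0018, p0024, p0027, p0028).

Provenance: lane `lit-hodgefound`, seat `lit-hodgefound-p27` gen 17 (agent `literature-prover-lit-hodgefound-p27-g17-0`), row g17-#5.
-/

set_option autoImplicit false

noncomputable section

namespace Literature.NumberTheory.ComplexMultiplication

/-! ### §0 Products of pairs on character modules: the amalgamated sum `(⊕ M_i)/⟨t_i − t_j⟩` -/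

namespace PairProduct

variable (R : Type*) [CommRing R] {I : Type*} {M : I → Type*} [∀ i, AddCommGroup (M i)] [∀ i, Module R (M i)] [DecidableEq I]
variable (t : ∀ i, M i)

/-- **The relations of the product of pairs** on character modules: the submodule of `⊕_i M_i` spanned by the `δ_i t_i − δ_j t_j` («the largest
subgroup of `∏ G_i` on which the characters `(g_i) ↦ t_{i₀}(g_{i₀})` agree» is cut out by these characters). [cite: Milne1999, §1 p. 48 L31–L35] -/
def rel : Submodule R (∀ i, M i) := Submodule.span R {x | ∃ i j : I, x = Pi.single i (t i) - Pi.single j (t j)}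

/-- `δ_i t_i − δ_j t_j` is a relation. [cite: Milne1999, §1 p. 48 L31–L35] -/
theorem single_sub_single_mem (i j : I) : Pi.single i (t i) - Pi.single j (t j) ∈ rel R t := Submodule.subset_span ⟨i, j, rfl⟩

/-- **`X^*(∏_i (G_i, t_i)) = (⊕_i X^*(G_i))/⟨t_i − t_j⟩`**, the character module of the product of pairs (the amalgamated sum of the `M_i` along
the `t_i`). [cite: Milne1999, §1 p. 48 L31–L35] -/
abbrev Amalg : Type _ := (∀ i, M i) ⧸ rel R t

/-- **The projection `⊕_i X^*(G_i) ↠ X^*(∏_i (G_i, t_i))`** (dual to the inclusion `G ⊂ ∏ G_i`), recorded as a linear map once and for all in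
this generality. [cite: Milne1999, §1 p. 48 L31–L35] -/
def proj : (∀ i, M i) →ₗ[R] Amalg R t := (rel R t).mkQ

/-- [cite: Milne1999, §1 p. 48 L31–L35] -/
@[simp] theorem proj_apply (x : ∀ i, M i) : proj R t x = Submodule.Quotient.mk x := rfl

/-- The projection is onto. [cite: Milne1999, §1 p. 48 L31–L35] -/
theorem proj_surjective : Function.Surjective (proj R t) := Submodule.mkQ_surjective _

/-- **The common class `t`**: `[δ_i t_i] = [δ_j t_j]` in the amalgamated sum («the common restriction of these characters to `G`»).
[cite: Milne1999, §1 p. 48 L31–L35] -/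
theorem mk_single_eq (i j : I) : (Submodule.Quotient.mk (Pi.single i (t i)) : Amalg R t) = Submodule.Quotient.mk (Pi.single j (t j)) :=
  (Submodule.Quotient.eq _).mpr (single_sub_single_mem R t i j)

/-- **The universal property** («universal with respect to the maps `(G, t) → (G_i, t_i)`», dually): a linear map out of `⊕_i M_i` taking one
and the same value on all the `δ_i t_i` factors through the amalgamated sum. [cite: Milne1999, §1 p. 48 L31–L35] -/
def liftOf {N : Type*} [AddCommGroup N] [Module R N] (F : (∀ i, M i) →ₗ[R] N)
    (hF : ∀ i j : I, F (Pi.single i (t i)) = F (Pi.single j (t j))) : Amalg R t →ₗ[R] N :=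
  (rel R t).liftQ F (by
    rw [rel, Submodule.span_le]
    rintro x ⟨i, j, rfl⟩
    rw [SetLike.mem_coe, LinearMap.mem_ker, map_sub, hF i j, sub_self])

/-- [cite: Milne1999, §1 p. 48 L31–L35] -/
@[simp] theorem liftOf_mk {N : Type*} [AddCommGroup N] [Module R N] (F : (∀ i, M i) →ₗ[R] N)
    (hF : ∀ i j : I, F (Pi.single i (t i)) = F (Pi.single j (t j))) (x : ∀ i, M i) :
    liftOf R t F hF (Submodule.Quotient.mk x) = F x := rfl

/-- The factorisation is onto when `F` is. [cite: Milne1999, §1 p. 48 L31–L35] -/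
theorem liftOf_surjective {N : Type*} [AddCommGroup N] [Module R N] (F : (∀ i, M i) →ₗ[R] N)
    (hF : ∀ i j : I, F (Pi.single i (t i)) = F (Pi.single j (t j))) (hs : Function.Surjective F) : Function.Surjective (liftOf R t F hF) := by
  intro n
  obtain ⟨x, rfl⟩ := hs n
  exact ⟨Submodule.Quotient.mk x, rfl⟩

variable {I' : Type*} {M' : I' → Type*} [∀ j, AddCommGroup (M' j)] [∀ j, Module R (M' j)] [DecidableEq I'] (t' : ∀ j, M' j)

/-- **Functoriality**: a linear map `⊕_i M_i → ⊕_j M′_j` carrying the relations of `t` into those of `t′` (e.g. one sending `δ_i t_i` to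
`δ_{σ(i)} t′_{σ(i)}`) induces a map of amalgamated sums — the shape of `X^*(α′) : X^*(T^K) → X^*(L^K)`. [cite: Milne1999, §1 p. 48 L31–L35; §6
p. 71 L22–L23] -/
def mapOf (F : (∀ i, M i) →ₗ[R] (∀ j, M' j)) (hF : ∀ i j : I, F (Pi.single i (t i)) - F (Pi.single j (t j)) ∈ rel R t') :
    Amalg R t →ₗ[R] Amalg R t' :=
  (rel R t).mapQ (rel R t') F (by
    rw [rel, Submodule.span_le]
    rintro x ⟨i, j, rfl⟩
    rw [SetLike.mem_coe, Submodule.mem_comap, map_sub]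
    exact hF i j)

/-- [cite: Milne1999, §1 p. 48 L31–L35] -/
@[simp] theorem mapOf_mk (F : (∀ i, M i) →ₗ[R] (∀ j, M' j)) (hF : ∀ i j : I, F (Pi.single i (t i)) - F (Pi.single j (t j)) ∈ rel R t')
    (x : ∀ i, M i) : mapOf R t t' F hF (Submodule.Quotient.mk x) = Submodule.Quotient.mk (F x) := rfl

/-- The induced map is onto when `F` is. [cite: Milne1999, §1 p. 48 L31–L35] -/
theorem mapOf_surjective (F : (∀ i, M i) →ₗ[R] (∀ j, M' j)) (hF : ∀ i j : I, F (Pi.single i (t i)) - F (Pi.single j (t j)) ∈ rel R t')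
    (hs : Function.Surjective F) : Function.Surjective (mapOf R t t' F hF) := by
  intro y
  induction y using Submodule.Quotient.induction_on with | H y => ?_
  obtain ⟨x, rfl⟩ := hs y
  exact ⟨Submodule.Quotient.mk x, rfl⟩

end PairProduct

namespace CosetGerm

open Finset BlockOnesMatrix OrbitTorus AlmostCartesian PairProduct

variable {Γ : Type*} [Group Γ] {ι : Γ} {Γ₀ D : Subgroup Γ}
variable [Fintype Γ] [DecidableEq Γ] [DecidablePred (· ∈ Γ₀)] [DecidablePred (· ∈ D)]
variable (R : Type*) [CommRing R] (h : Setting ι Γ₀ D)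

/-! ### §1 `X^*(T^K)`, `X^*(L^K)` and the arrows of the right-hand square -/

/-- A base point of the orbit class `c ∈ I` (any representative; the canonical character does not depend on it, `tChar_eq_tFam`).
[cite: Milne1999, §2 p. 55 L45–L47 («independent of the choice of `ψ ∈ Ψ`»)] -/
def basePt (c : CMOrbits h) : MulAction.orbitRel.Quotient.orbit c := ⟨c.out, MulAction.orbitRel.Quotient.mem_orbit.mpr c.out_eq'⟩

/-- **`t^c ∈ X^*(T^c)`** for `c ∈ I`: the canonical character `[δ_Φ + δ_{ιΦ}]` («`ψ + ιψ`», g15-#1 `tChar`). [cite: Milne1999, §2 p. 55 L45–L48;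
Thm 2.6 p. 56] -/
def tFam (c : CMOrbits h) : CharModule R (MulAction.orbitRel.Quotient.orbit c) ι := tChar R ι (basePt h c)

omit [Fintype Γ] [DecidablePred (· ∈ Γ₀)] [DecidablePred (· ∈ D)] in
/-- `t^c` is the class of `δ_Φ + δ_{ιΦ}` for every `Φ ∈ c`. [cite: Milne1999, §2 p. 55 L45–L47] -/
theorem tChar_eq_tFam (c : CMOrbits h) (Φ : MulAction.orbitRel.Quotient.orbit c) : tChar R ι Φ = tFam R h c :=
  tChar_eq R ι h.mul_self Φ (basePt h c)

/-- A base point of the orbit class `c′ ∈ I′`. [cite: Milne1999, §4 p. 61 (Thm 4.3)] -/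
def basePt' (c' : WeilOrbits R h) : MulAction.orbitRel.Quotient.orbit c' := ⟨c'.out, MulAction.orbitRel.Quotient.mem_orbit.mpr c'.out_eq'⟩

/-- **`l^{c′} ∈ X^*(L^{c′})`** for `c′ ∈ I′`: the canonical character `[δ_π + δ_{ιπ}]`. [cite: Milne1999, §4 p. 61 (Thm 4.3), p. 62 L15–L16] -/
def lFam (c' : WeilOrbits R h) : CharModule R (MulAction.orbitRel.Quotient.orbit c') ι := tChar R ι (basePt' R h c')

omit [Fintype Γ] [DecidablePred (· ∈ Γ₀)] [DecidablePred (· ∈ D)] in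
/-- `l^{c′}` is the class of `δ_π + δ_{ιπ}` for every `π ∈ c′`. [cite: Milne1999, §2 p. 55 L45–L47; §4 p. 61] -/
theorem tChar_eq_lFam (c' : WeilOrbits R h) (w : MulAction.orbitRel.Quotient.orbit c') : tChar R ι w = lFam R h c' :=
  tChar_eq R ι h.mul_self w (basePt' R h c')

/-- **`X^*(T^K) = X^*(∏_{Ψ∈I} (T^Ψ, t^Ψ))`** (THEOREM 2.6 read on characters): the amalgamated sum of the `X^*(T^c)`, `c ∈ I`, along the `t^c`.
[cite: Milne1999, Thm 2.6 p. 56; §1 p. 48 L31–L35] -/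
abbrev TK : Type _ := Amalg R (tFam R h)

/-- **`X^*(L^K) = X^*(∏_{Π∈I′} (L^Π, l^Π))`** (THEOREM 4.3 / §4 p. 62 read on characters). [cite: Milne1999, §4 p. 62 L15–L16; §1 p. 48 L31–L35] -/
abbrev LK : Type _ := Amalg R (lFam R h)

/-- **`t^K ∈ X^*(T^K)`**, the common class of the `t^c`. [cite: Milne1999, Thm 2.6 p. 56; §1 p. 48 L31–L35] -/
def tK : TK R h := Submodule.Quotient.mk (Pi.single (Quotient.mk'' (psiType h) : CMOrbits h) (tFam R h (Quotient.mk'' (psiType h))))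

omit [DecidablePred (· ∈ D)] in
/-- Every `[δ_c (δ_Φ + δ_{ιΦ})]`, `Φ ∈ c`, is `t^K`. [cite: Milne1999, Thm 2.6 p. 56; §1 p. 48 L31–L35] -/
theorem mk_single_tChar_eq_tK (c : CMOrbits h) (Φ : MulAction.orbitRel.Quotient.orbit c) :
    (Submodule.Quotient.mk (Pi.single c (tChar R ι Φ)) : TK R h) = tK R h := by
  rw [tChar_eq_tFam R h c Φ]
  exact mk_single_eq R (tFam R h) c _

/-- **`l^K ∈ X^*(L^K)`**, the common class of the `l^{c′}`. [cite: Milne1999, §4 p. 62 L15–L16; §1 p. 48 L31–L35] -/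
def lK : LK R h :=
  Submodule.Quotient.mk (Pi.single (redI R h (Quotient.mk'' (psiType h))) (lFam R h (redI R h (Quotient.mk'' (psiType h)))))

omit [DecidablePred (· ∈ D)] in
/-- Every `[δ_{c′} (δ_π + δ_{ιπ})]`, `π ∈ c′`, is `l^K`. [cite: Milne1999, §4 p. 62 L15–L16; §1 p. 48 L31–L35] -/
theorem mk_single_tChar_eq_lK (c' : WeilOrbits R h) (w : MulAction.orbitRel.Quotient.orbit c') :
    (Submodule.Quotient.mk (Pi.single c' (tChar R ι w)) : LK R h) = lK R h := by
  rw [tChar_eq_lFam R h c' w]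
  exact mk_single_eq R (lFam R h) c' _

section Maps

variable [NoZeroDivisors R] (h2 : (2 : R) ≠ 0)

/-- **`X^*(T^K) → X^*(S^K)`** (the top arrow of the right-hand square), induced by `γ = ⊕_c (X^*(T^c) → X^*(S^K))` of g17-#4, which sends every
`t^c` to `s^K = Σ_γ γ`. [cite: Milne1999, §6 p. 68 L106–L118; §3 p. 59 L3–L6 («its composite with `t^Ψ` is `s`»)] -/
def tKToS : TK R h →ₗ[R] serreLattice ι R :=
  liftOf R (tFam R h) (N := ↥(serreLattice ι R)) (tSumToSs R h h2) fun c c' => Subtype.ext (by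
    rw [coe_tSumToSs, coe_tSumToSs, tSumToS_single, tSumToS_single, tFam, tFam, orbitToS, orbitToS, liftChar_tChar, liftChar_tChar])

omit [DecidablePred (· ∈ Γ₀)] [DecidablePred (· ∈ D)] in
/-- [cite: Milne1999, §6 p. 68 L106–L118] -/
@[simp] theorem tKToS_mk (x : TSum R h) : tKToS R h h2 (Submodule.Quotient.mk x) = tSumToSs R h h2 x := rfl

omit [DecidablePred (· ∈ D)] in
/-- **`t^K ↦ s^K`** (a map of pairs). [cite: Milne1999, §3 p. 59 L5–L6; Prop. 3.5 p. 59] -/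
theorem tKToS_tK : (tKToS R h h2 (tK R h) : Γ →₀ R) = onesFun R := by
  rw [tK, tKToS_mk, coe_tSumToSs, tSumToS_single, tFam, orbitToS, liftChar_tChar]

omit [DecidablePred (· ∈ D)] in
/-- The top arrow is onto (as `γ` is, g17-#4 `tSumToSs_surjective`). [cite: Milne1999, §6 p. 71 L19] -/
theorem tKToS_surjective : Function.Surjective (tKToS R h h2) := liftOf_surjective R _ _ _ (tSumToSs_surjective R h h2)

/-- **`X^*(L^K) → X^*(P^K)`** (the bottom arrow), induced by `β = ⊕_{c′} (X^*(L^{c′}) → X^*(P^K))` of g17-#4, which sends every `l^{c′}` to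
`push(s^K)`. [cite: Milne1999, §6 p. 68 L106–L118; §4 p. 62 («THE MAP `β^K : P^K → L^K`»)] -/
def lKToP : LK R h →ₗ[R] weilLattice ι D R :=
  liftOf R (lFam R h) (N := ↥(weilLattice ι D R)) (lSumToPw R h h2) fun c c' => Subtype.ext (by
    rw [coe_lSumToPw, coe_lSumToPw, lSumToP_single, lSumToP_single, lFam, lFam, orbitToP, orbitToP, liftChar_tChar, liftChar_tChar])

omit [DecidablePred (· ∈ Γ₀)] [DecidablePred (· ∈ D)] in
/-- [cite: Milne1999, §6 p. 68 L106–L118] -/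
@[simp] theorem lKToP_mk (y : LSum R h) : lKToP R h h2 (Submodule.Quotient.mk y) = lSumToPw R h h2 y := rfl

omit [DecidablePred (· ∈ D)] in
/-- **`l^K ↦ push(s^K)`** (a map of pairs: «This map sends `p^K` to `l^Π`», dually). [cite: Milne1999, §4 p. 62 L24–L27] -/
theorem lKToP_lK : (lKToP R h h2 (lK R h) : Γ ⧸ D →₀ R) = pushFun R ((↑) : Γ → Γ ⧸ D) (onesFun R) := by
  rw [lK, lKToP_mk, coe_lSumToPw, lSumToP_single, lFam, orbitToP, liftChar_tChar]

omit [DecidablePred (· ∈ D)] in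
/-- The bottom arrow is onto (as `β` is, g17-#4 `lSumToPw_surjective`). [cite: Milne1999, §6 p. 71 L19] -/
theorem lKToP_surjective : Function.Surjective (lKToP R h h2) := liftOf_surjective R _ _ _ (lSumToPw_surjective R h h2)

omit [DecidablePred (· ∈ Γ₀)] [DecidablePred (· ∈ D)] [NoZeroDivisors R] in
/-- `α″` carries the relations of `X^*(T^K)` into those of `X^*(L^K)`: `α″(δ_c t^c) = δ_{π(c)} l^{π(c)}` («sending `t^Ψ` to `l^Π`»).
[cite: Milne1999, §5 p. 65; §6 p. 71 L22–L23] -/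
theorem alphaSum_single_tFam (c : CMOrbits h) :
    alphaSum R h (Pi.single c (tFam R h c)) = Pi.single (redI R h c) (lFam R h (redI R h c)) := by
  rw [alphaSum_single, tFam, pushOrbit, push_tChar, tChar_eq_lFam]

/-- **`X^*(α′) : X^*(T^K) → X^*(L^K)`** (the left arrow of the right-hand square), induced by `α″` summand by summand. [cite: Milne1999, §6 p. 71
L22–L23; §5 Thm 5.4 p. 65] -/
def alphaK : TK R h →ₗ[R] LK R h :=
  mapOf R (tFam R h) (lFam R h) (alphaSum R h) fun c c' => by
    rw [alphaSum_single_tFam, alphaSum_single_tFam]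
    exact single_sub_single_mem R _ _ _

omit [DecidablePred (· ∈ Γ₀)] [DecidablePred (· ∈ D)] [NoZeroDivisors R] in
/-- [cite: Milne1999, §6 p. 71 L22–L23] -/
@[simp] theorem alphaK_mk (x : TSum R h) : alphaK R h (Submodule.Quotient.mk x) = Submodule.Quotient.mk (alphaSum R h x) := rfl

omit [DecidablePred (· ∈ D)] [NoZeroDivisors R] in
/-- **`t^K ↦ l^K`** (a map of pairs). [cite: Milne1999, §5 Thm 5.4 p. 65; §6 p. 71 L22–L23] -/
theorem alphaK_tK : alphaK R h (tK R h) = lK R h := by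
  rw [tK, alphaK_mk, alphaSum_single_tFam, lK]

omit [DecidablePred (· ∈ Γ₀)] [DecidablePred (· ∈ D)] [NoZeroDivisors R] in
/-- The left arrow is onto (as `α″` is, g17-#4 `alphaSum_surjective`). [cite: Milne1999, §6 p. 71 L19] -/
theorem alphaK_surjective : Function.Surjective (alphaK R h) := mapOf_surjective R _ _ _ _ (alphaSum_surjective R h)

omit [DecidablePred (· ∈ Γ₀)] [DecidablePred (· ∈ D)] in
/-- The right-hand square commutes (from g17-#4 `sum_square_comm`). [cite: Milne1999, §6 p. 71 L22–L23; §5 Lemma 5.1] -/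
theorem pairProduct_square_comm (x : TK R h) : alphaP ι D R (tKToS R h h2 x) = lKToP R h h2 (alphaK R h x) := by
  induction x using Submodule.Quotient.induction_on with | H x => ?_
  rw [tKToS_mk, alphaK_mk, lKToP_mk, sum_square_comm]

/-! ### §2 The right-hand square is almost cartesian (end of the proof of THEOREM 6.1 at level `K`) -/

/-- **«Therefore the right hand square is almost Cartesian, which completes the proof of Theorem 6.1»**: for `2 ≠ 0` and `d ≠ 0` in `R`,
the square `X^*(T^K) → X^*(S^K)` over `X^*(L^K) → X^*(P^K)` (verticals `X^*(α′)`, `X^*(α)`) is almost cartesian — LEMMA 6.10 (g17-#4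
`isAlmostCartesian_sum`) transferred along the three quotient maps `⊕ X^*(T^Φ) ↠ X^*(T^K)`, `⊕ X^*(L^Π) ↠ X^*(L^K)` by g17-#4
`IsAlmostCartesian.of_quotients` («the composite of the maps `Ker(α″) → Ker(α′) → Ker(α)` is surjective, which implies that `Ker(α′) → Ker(α)`
is surjective»). This is the statement «It suffices to prove that [the square] is almost Cartesian» of p. 68 for the fields `K = Q·F` of p. 69,
in the model. [cite: Milne1999, §6 p. 68 L106–L118, p. 71 L22 – p. 72 L4] -/
theorem isAlmostCartesian_pairProduct (hd : (Fintype.card D : R) ≠ 0) :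
    IsAlmostCartesian (R := R) (N' := TK R h) (N := ↥(serreLattice ι R)) (M' := LK R h) (M := ↥(weilLattice ι D R))
      (alphaK R h) (tKToS R h h2) (lKToP R h h2) (alphaP ι D R) := by
  -- the quotient maps are §0's pre-built `proj` (elaborating `Submodule.mkQ` afresh on these products is prohibitively slow)
  refine IsAlmostCartesian.of_quotients (T := TK R h) (L := LK R h) (isAlmostCartesian_sum R h h2 hd) (proj R (tFam R h))
    (proj R (lFam R h)) (tKToS R h h2) (lKToP R h h2) (alphaK R h) (proj_surjective R _) (proj_surjective R _)
    (fun x => ?_) (fun y => ?_) fun x => ?_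
  · rw [proj_apply, tKToS_mk]
  · rw [proj_apply, lKToP_mk]
  · rw [proj_apply, proj_apply, alphaK_mk]

/-- **«`P^K = S^K ∩ L^K` (inside `T^K`), or, equivalently, `P^K −(β^K, −α^K)→ L^K × S^K −(α′^K γ^K)→ T^K` is exact» read on characters, in
the model**: for `2 ≠ 0` and `d ≠ 0` in `R`, a pair `(y, s) ∈ X^*(L^K) ⊕ X^*(S^K)` with `β(y) = X^*(α)(s)` in `X^*(P^K)` is the image `(X^*(α′)(x), γ(x))`
of an `x ∈ X^*(T^K)`, and conversely — exactness of `X^*(T^K) → X^*(L^K) ⊕ X^*(S^K) → X^*(P^K)` at the middle («i.e., if `N′ → M′ ⊕ N → M` is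
exact», packaged as `Function.Exact` by g16-#8 `isAlmostCartesian_iff_exact`), i.e. `X^*(P^K)` is the amalgamated sum of `X^*(L^K)` and `X^*(S^K)`
over `X^*(T^K)` — the character-module form, at level `K`, of THEOREM 6.1 «identifies `P` with `L ∩ S` (intersection in `T`)».
[cite: Milne1999, §6 p. 66 L3–L4 (Theorem 6.1), L13–L17; p. 66 («Almost cartesian squares»)] -/
theorem exact_pairProduct (hd : (Fintype.card D : R) ≠ 0) (y : LK R h) (s : serreLattice ι R) :
    lKToP R h h2 y = alphaP ι D R s ↔ ∃ x : TK R h, alphaK R h x = y ∧ tKToS R h h2 x = s := by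
  constructor
  · exact (isAlmostCartesian_pairProduct R h h2 hd).lift y s
  · rintro ⟨x, rfl, rfl⟩
    exact (isAlmostCartesian_pairProduct R h h2 hd).comm x

omit h2 in
/-- **The right-hand square over `ℤ`.** [cite: Milne1999, §6 p. 68 L106–L118, p. 71 L22 – p. 72 L4] -/
theorem int_isAlmostCartesian_pairProduct :
    IsAlmostCartesian (R := ℤ) (N' := TK ℤ h) (N := ↥(serreLattice ι ℤ)) (M' := LK ℤ h) (M := ↥(weilLattice ι D ℤ))
      (alphaK ℤ h) (tKToS ℤ h two_ne_zero) (lKToP ℤ h two_ne_zero) (alphaP ι D ℤ) :=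
  isAlmostCartesian_pairProduct ℤ h two_ne_zero (by exact_mod_cast Fintype.card_ne_zero)

end Maps

end CosetGerm

end Literature.NumberTheory.ComplexMultiplication
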